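import Summits.QuantumAdvantage.QuantumAdvantage.Theorems.WhiteBoxWalkWbwThesisWeakOW
import Summits.QuantumAdvantage.QuantumAdvantage.Theorems.WhiteBoxWalkWbwThesisAssemble
import Literature.Computability.Cryptography.YaoInvProgram
import Literature.Computability.Cryptography.ShorAssemblyLeavesProofs
import Literature.Computability.QuantumComplexity.GeneratedCircuitsSolvable

/-!
# Route `WhiteBoxWalk`, crux `WbwThesis` (stmt-QuantumAdvantage-2238): **the factoring assumption implies X**

Line `Sketch` (lead prover; Cruxes/WbwThesis/PICKED.md, Lines/Sketch.lean). The crux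
`WbwThesis` (X, "planted unique-answer white-box quantum advantage") is conjecture-grade in both
directions (X ⇒ `PromiseBQP ⊄ PromiseBPP'` ⇒ `P ≠ PSPACE`-type consequences; `¬X` ⇒ average-case
solvers for every plantable structure, e.g. DLOG/factoring — Disproof.lean §1). This file lands the
benchmark CONDITIONAL reduction of X to ONE standard named conjecture, the average-case FACTORING
ASSUMPTION (`Theorems/FactoringAssumption.lean`, Goldreich 2001 §2.2.4.1; registered `@[conjecture]`):

  `wbwThesis_of_factoringAssumption : FactoringAssumption → WbwThesis`.

Everything else is PROVED (six registered stubs, each its own accepted file) from four theorems the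
tree already holds — Yao's amplification (`Yao.Params.isOneWay_g`, `yaoFun_polyTime_holds`,
`yaoRun_polyTime_holds`), Shor's factoring theorem in FBQP form (`factoring_mem_FBQP_holds`), AKS
(`PRIMES_mem_P_holds` via `primeFn_mem_FP`) and the classical wrap of quantum search
(`isQSolvable_classicalWrap_dep`):

* witness objects (`WhiteBoxWalkDefs.lean`): `fPQ` (prime-pair product, Goldreich's `f_mult` with an
  AKS-certified tagged hard branch), `genPQ := pqParams.g` (Yao's direct product of `fPQ`), the
  answer `ansPQ w` = canonical `genPQ`-preimage `prePQ w` (blockwise split at the least prime factor)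
  zero-padded to `|genPQ w|`;
* (C): `fPQ ∈ FP` (`stub_fPQ_polyTime`), `fPQ` weakly one-way under the factoring assumption
  (`stub_weakOW`: prime density by the tree's PNT + a factoring adversary per parity), hence `genPQ`
  strongly one-way by Yao (`isOneWay_genPQ`), hence clause (C) by the generic bridge `stub_bridge`
  (a PPT printing the canonical preimage is an inverter) with `stub_canon` (`prePQ` IS a preimage);
* (Q): ONE uniform Clifford+T family outputs `ansPQ w` on `genPQ w` for EVERY seed (`clauseQ_genPQ`):
  Shor's family factors `bigProd w` — the product of the hard-branch block semiprimes, extracted in FP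
  by `stub_extract` — and the canonical preimage is re-assembled in FP by `stub_assemble`, inside
  `isQSolvable_classicalWrap_dep`.

Calibration (route text, kill criterion (c)): this is the number-theoretic instantiation of X ("then
nothing beyond Shor/AvgCase"); its role is the benchmark every Shor-neutral engine (crux
`WbwObfuscatedGluedTrees`, item `WbwEngine`) must beat. The conjecture itself is the line's seventh
registered stub (`stub_factoring`) and is NOT landed (it cannot be: conjecture-grade).

References: O. Goldreich, *Foundations of Cryptography I* (2001), §2.2.4.1, Thm. 2.3.2; A. Yao, FOCS
1982; P. Shor, SIAM J. Comput. 26 (1997) §5; Agrawal–Kayal–Saxena, Ann. Math. 160 (2004);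
Bernstein–Vazirani 1997 §8 (classical computation inside BQP).
-/

noncomputable section

set_option linter.dupNamespace false -- D-0017: single-problem summit ⇒ `QuantumAdvantage.QuantumAdvantage` by design

namespace Summit.QuantumAdvantage.QuantumAdvantage.Theorems.WhiteBoxWalk

open Summit.QuantumAdvantage.QuantumAdvantage.Theses.WhiteBoxWalk (WbwThesis)
open Summit.QuantumAdvantage.QuantumAdvantage.Theorems (FactoringAssumption)
open Literature.Computability.Cryptography Literature.Computability.Complexity
open Literature.Computability.QuantumComplexity (isQSolvable_classicalWrap_dep)
open _root_.Computability Polynomial Filter Asymptotics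

/-- **`genPQ` is a (strong) one-way function under the factoring assumption**: Yao's amplification
(tree: `Yao.Params.isOneWay_g` with the efficiency facts `yaoFun_polyTime_holds`,
`yaoRun_polyTime_holds`) applied to the weakly one-way `fPQ` (`stub_weakOW`, `stub_fPQ_polyTime`).
[Goldreich 2001, Thm. 2.3.2 with §2.2.4.1] -/
theorem isOneWay_genPQ (hF : FactoringAssumption) : IsOneWay genPQ :=
  Yao.Params.isOneWay_g (P := pqParams) pqParams_qpos pqParams_lenBound
    (stub_weakOW hF stub_fPQ_polyTime) (yaoFun_polyTime_holds pqParams stub_fPQ_polyTime)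
    fun A cl hB hcl => isPPT_inv_of yaoRun_polyTime_holds pqParams A cl stub_fPQ_polyTime hB hcl

/-- **Clause (Q) for `(genPQ, ansPQ)`, unconditionally**: ONE uniform oracle-free Clifford+T family
outputs `ansPQ w` (as a prefix, with probability `≥ 2/3`) on input `genPQ w`, for EVERY `w` — Shor's
factoring family (`factoring_mem_FBQP_holds`) run on the product `bigProd w` extracted by the FP
program of `stub_extract`, inside the classical wrap `isQSolvable_classicalWrap_dep` whose FP
post-processing is the re-assembly program of `stub_assemble`. [Shor 1997, §5; Bernstein–Vazirani
1997, §8] -/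
theorem clauseQ_genPQ : ∃ F : QCircuitFamily cliffordT, F.IsOracleFree ∧ F.IsUniform ∧
    ∀ w, (2 / 3 : ℝ) ≤ F.kernelProb 0 (genPQ w) {y | ansPQ w <+: y} := by
  obtain ⟨h, hh, hspec⟩ := stub_extract
  obtain ⟨g, hg, gspec⟩ := stub_assemble
  obtain ⟨F, hFfree, hU, hF⟩ := factoring_mem_FBQP_holds
  -- the inner event asked of Shor's family on `h x`
  let S : List Bool → Set (List Bool) := fun x =>
    {y | encodingListNatBool.encode (decodeNat (h x)).primeFactorsList <+: y}
  have hS : ∀ x, (2 / 3 : ℝ) ≤ F.kernelProb 0 (h x) (S x) := fun x => hF (h x)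
  obtain ⟨F', hF'free, hU', hF'⟩ := isQSolvable_classicalWrap_dep h g hh hg hFfree hU S hS
  refine ⟨F', hF'free, hU', fun w => (hF' (genPQ w)).trans (F'.kernelProb_mono 0 _ ?_)⟩
  rintro z ⟨y, hy, hz⟩
  have hy' : factorCode (bigProd w) <+: y := by
    simpa only [S, Set.mem_setOf_eq, hspec w, decode_encodeNat, factorCode] using hy
  show ansPQ w <+: z
  simpa only [gspec w y hy'] using hz

/-- **The factoring assumption implies `WbwThesis`** (crux `stmt-QuantumAdvantage-2238`, line
`Sketch`): a CONDITIONAL result — the hypothesis is the standard average-case factoring conjecture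
`Theorems/FactoringAssumption.lean` (Goldreich 2001 §2.2.4.1), registered `@[conjecture]` and never
expected to be discharged; the construction (`genPQ`, `ansPQ`) and every other ingredient are proved.
Composition: the generic bridge `stub_bridge` (one-way function + canonical preimage computed by one
uniform quantum family ⇒ X) applied to `genPQ` (one-way by `isOneWay_genPQ`), `prePQ` (a canonical
preimage by `stub_canon`) and `clauseQ_genPQ`. [Goldreich 2001, §2.2.4.1, Thm. 2.3.2; Shor 1997, §5] -/
theorem wbwThesis_of_factoringAssumption (hF : FactoringAssumption) : WbwThesis :=
  stub_bridge (gen := genPQ) (pre := prePQ) (isOneWay_genPQ hF) (fun w => (stub_canon w).1)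
    (fun w => (stub_canon w).2.1) (fun w => (stub_canon w).2.2) clauseQ_genPQ

end Summit.QuantumAdvantage.QuantumAdvantage.Theorems.WhiteBoxWalk

end
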